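import Summits.ABC.ABC.Theses.IneffectiveSubspace

/-!
# Certificates for line `Sketch` — crux `IneffectiveSubspace.DepthCountedABC` (stmt-ABC-14938), II: the cores

The skeleton `Cruxes/DepthCountedABC/Lines/Sketch.lean` (lead `prover-line-stmt-ABC-14938-0`) has two arithmetic
open cores besides `LW4`: `stub_deepSmallFullSize` (the member `a` at full size on the deep cells
`1 ≤ ω₅(abc) ≤ K`: `c < C·(a·rad(bc))^(1+δ)`) and `stub_allPowerRich` (abc with exponent `1+δ` on the cell
`ω₅ ≤ K` for triples all of whose members are power-rich).  This file certifies that both — and the 5-free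
T-statement fed by the dictionary — are WEAKENINGS OF THE CRUX on their cells, hence consistent with it and not
refutable short of refuting the crux itself:

* `smallFullSizeFiveFree_of_depthCountedABC`, `smallFullSizeDeep_of_depthCountedABC` — from
  `rad(abc) ≤ a · rad(bc)`;
* `allPowerRich_of_depthCountedABC` — drop the three power-richness hypotheses.

Statements fully unfolded (the skeleton's `def`s are not importable).  Sources: the skeleton; Mathlib only.
Companion file: `IneffectiveSubspaceDepthCountedABCCertificatesDictionary.lean`.
-/

-- `Summit.<Summit>.<Problem>` is the mandated summit-side namespace (CONVENTIONS §2); for the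
-- single-conjunct summit `ABC` the two coincide, so the duplicate `ABC.ABC` is deliberate.
set_option linter.dupNamespace false

namespace Summit.ABC.ABC.Theorems.DepthCountedABC

open scoped BigOperators
open UniqueFactorizationMonoid (radical)

/-! ## The arithmetic cores are weakenings of the crux on their cells -/

/-- `rad(abc) ≤ a · rad(bc)` for `a ≥ 1`. [folklore] -/
theorem certificates_rad_le_mul_radical {a : ℕ} (ha : 0 < a) (b c : ℕ) :
    Literature.NumberTheory.DiophantineGeometry.rad a b c ≤ a * radical (b * c) := by
  rw [Literature.NumberTheory.DiophantineGeometry.rad_def, mul_assoc]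
  calc radical (a * (b * c)) ≤ radical a * radical (b * c) :=
        Nat.le_of_dvd (mul_pos (Nat.radical_pos a) (Nat.radical_pos _))
          UniqueFactorizationMonoid.radical_mul_dvd
    _ ≤ a * radical (b * c) :=
        Nat.mul_le_mul_right _ (Nat.le_of_dvd ha UniqueFactorizationMonoid.radical_dvd_self)

/-- The crux on a cell gives the T-statement (member `a` at full size) on that cell: from
`c < C·rad(abc)^(1+δ)` and `rad(abc) ≤ a·rad(bc)`. [folklore] -/
theorem certificates_smallFullSize_of_cell {K : ℕ} {δ C : ℝ} (hδ : 0 < δ)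
    (h : ∀ a b c : ℕ, Literature.NumberTheory.DiophantineGeometry.IsABCTriple a b c →
      ((a * b * c).primeFactors.filter (fun p => 5 ≤ (a * b * c).factorization p)).card ≤ K →
      (c : ℝ) < C * ((Literature.NumberTheory.DiophantineGeometry.rad a b c : ℕ) : ℝ) ^ (1 + δ))
    {a b c : ℕ} (ht : Literature.NumberTheory.DiophantineGeometry.IsABCTriple a b c)
    (hK : ((a * b * c).primeFactors.filter (fun p => 5 ≤ (a * b * c).factorization p)).card ≤ K) :
    (c : ℝ) < max C 1 * ((a : ℝ) * ((radical (b * c) : ℕ) : ℝ)) ^ (1 + δ) := by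
  have key := h a b c ht hK
  have hle : ((Literature.NumberTheory.DiophantineGeometry.rad a b c : ℕ) : ℝ) ≤
      (a : ℝ) * ((radical (b * c) : ℕ) : ℝ) := by
    exact_mod_cast certificates_rad_le_mul_radical ht.1 b c
  have hpow : ((Literature.NumberTheory.DiophantineGeometry.rad a b c : ℕ) : ℝ) ^ (1 + δ) ≤
      ((a : ℝ) * ((radical (b * c) : ℕ) : ℝ)) ^ (1 + δ) :=
    Real.rpow_le_rpow (Nat.cast_nonneg _) hle (by linarith)
  have hnn : (0 : ℝ) ≤ ((a : ℝ) * ((radical (b * c) : ℕ) : ℝ)) ^ (1 + δ) :=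
    Real.rpow_nonneg (mul_nonneg (Nat.cast_nonneg _) (Nat.cast_nonneg _)) _
  have hr0 : (0 : ℝ) ≤ ((Literature.NumberTheory.DiophantineGeometry.rad a b c : ℕ) : ℝ) ^ (1 + δ) :=
    Real.rpow_nonneg (Nat.cast_nonneg _) _
  calc (c : ℝ) < C * ((Literature.NumberTheory.DiophantineGeometry.rad a b c : ℕ) : ℝ) ^ (1 + δ) := key
    _ ≤ max C 1 * ((Literature.NumberTheory.DiophantineGeometry.rad a b c : ℕ) : ℝ) ^ (1 + δ) :=
        mul_le_mul_of_nonneg_right (le_max_left _ _) hr0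
    _ ≤ max C 1 * ((a : ℝ) * ((radical (b * c) : ℕ) : ℝ)) ^ (1 + δ) :=
        mul_le_mul_of_nonneg_left hpow (le_trans zero_le_one (le_max_right _ _))

/-- **The crux implies the T-statement on the 5-free cell** (`SmallFullSizeFiveFree` of the skeleton,
unfolded). [folklore] -/
theorem smallFullSizeFiveFree_of_depthCountedABC
    (h : Summit.ABC.ABC.Theses.IneffectiveSubspace.DepthCountedABC) :
    ∀ δ : ℝ, 0 < δ → ∃ C : ℝ, 0 < C ∧ ∀ a b c : ℕ,
      Literature.NumberTheory.DiophantineGeometry.IsABCTriple a b c →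
      ((a * b * c).primeFactors.filter (fun p => 5 ≤ (a * b * c).factorization p)).card = 0 →
      (c : ℝ) < C * ((a : ℝ) * ((UniqueFactorizationMonoid.radical (b * c) : ℕ) : ℝ)) ^ (1 + δ) := by
  intro δ hδ
  obtain ⟨C, _hC, hcell⟩ := h 0 δ hδ
  exact ⟨max C 1, lt_max_of_lt_right one_pos, fun a b c ht h0 =>
    certificates_smallFullSize_of_cell hδ hcell ht h0.le⟩

/-- **The crux implies the T-statement on the deep cells** (`SmallFullSizeDeep` = `stub_deepSmallFullSize` of
the skeleton, unfolded): core T_K is a weakening of the crux on its cells. [folklore] -/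
theorem smallFullSizeDeep_of_depthCountedABC
    (h : Summit.ABC.ABC.Theses.IneffectiveSubspace.DepthCountedABC) :
    ∀ K : ℕ, ∀ δ : ℝ, 0 < δ → ∃ C : ℝ, 0 < C ∧ ∀ a b c : ℕ,
      Literature.NumberTheory.DiophantineGeometry.IsABCTriple a b c →
      1 ≤ ((a * b * c).primeFactors.filter (fun p => 5 ≤ (a * b * c).factorization p)).card →
      ((a * b * c).primeFactors.filter (fun p => 5 ≤ (a * b * c).factorization p)).card ≤ K →
      (c : ℝ) < C * ((a : ℝ) * ((UniqueFactorizationMonoid.radical (b * c) : ℕ) : ℝ)) ^ (1 + δ) := by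
  intro K δ hδ
  obtain ⟨C, _hC, hcell⟩ := h K δ hδ
  exact ⟨max C 1, lt_max_of_lt_right one_pos, fun a b c ht _h1 hK =>
    certificates_smallFullSize_of_cell hδ hcell ht hK⟩

/-- **The crux implies the P-statement** (`AllPowerRich` = `stub_allPowerRich` of the skeleton, unfolded): core P
is the crux restricted to the all-power-rich sub-cell (drop the three hypotheses). [folklore] -/
theorem allPowerRich_of_depthCountedABC
    (h : Summit.ABC.ABC.Theses.IneffectiveSubspace.DepthCountedABC) :
    ∀ K : ℕ, ∀ δ : ℝ, 0 < δ → ∃ C : ℝ, 0 < C ∧ ∀ a b c : ℕ,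
      Literature.NumberTheory.DiophantineGeometry.IsABCTriple a b c →
      ((a * b * c).primeFactors.filter (fun p => 5 ≤ (a * b * c).factorization p)).card ≤ K →
      ((UniqueFactorizationMonoid.radical a : ℕ) : ℝ) ^ (1 + δ) * (c : ℝ) ^ δ < (a : ℝ) →
      ((UniqueFactorizationMonoid.radical b : ℕ) : ℝ) ^ (1 + δ) * (c : ℝ) ^ δ < (b : ℝ) →
      ((UniqueFactorizationMonoid.radical c : ℕ) : ℝ) ^ (1 + δ) * (c : ℝ) ^ δ < (c : ℝ) →
      (c : ℝ) < C * ((Literature.NumberTheory.DiophantineGeometry.rad a b c : ℕ) : ℝ) ^ (1 + δ) := by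
  intro K δ hδ
  obtain ⟨C, hC, hcell⟩ := h K δ hδ
  exact ⟨C, hC, fun a b c ht hK _ _ _ => hcell a b c ht hK⟩

/-! ## Registered certificate stub of the crux item (stmt-ABC-14938), by name and signature -/

/-- **Registered certificate `stub_coresOfCrux`**: the crux implies the 5-free T-statement, the deep T-statement
(`stub_deepSmallFullSize`) and the P-statement (`stub_allPowerRich`) of line `Sketch` — the arithmetic cores are
weakenings of the crux on their cells. [folklore] -/
theorem stub_coresOfCrux : Summit.ABC.ABC.Theses.IneffectiveSubspace.DepthCountedABC → (∀ δ : ℝ, 0 < δ → ∃ C : ℝ, 0 < C ∧ ∀ a b c : ℕ, Literature.NumberTheory.DiophantineGeometry.IsABCTriple a b c → ((a * b * c).primeFactors.filter (fun p => 5 ≤ (a * b * c).factorization p)).card = 0 → (c : ℝ) < C * ((a : ℝ) * ((UniqueFactorizationMonoid.radical (b * c) : ℕ) : ℝ)) ^ (1 + δ)) ∧ (∀ K : ℕ, ∀ δ : ℝ, 0 < δ → ∃ C : ℝ, 0 < C ∧ ∀ a b c : ℕ, Literature.NumberTheory.DiophantineGeometry.IsABCTriple a b c → 1 ≤ ((a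 * b * c).primeFactors.filter (fun p => 5 ≤ (a * b * c).factorization p)).card → ((a * b * c).primeFactors.filter (fun p => 5 ≤ (a * b * c).factorization p)).card ≤ K → (c : ℝ) < C * ((a : ℝ) * ((UniqueFactorizationMonoid.radical (b * c) : ℕ) : ℝ)) ^ (1 + δ)) ∧ (∀ K : ℕ, ∀ δ : ℝ, 0 < δ → ∃ C : ℝ, 0 < C ∧ ∀ a b c : ℕ, Literature.NumberTheory.DiophantineGeometry.IsABCTriple a b c → ((a * b * c).primeFactors.filter (fun p => 5 ≤ (a * b * c).factorization p)).card ≤ K → ((UniqueFactorizationMonoid.radical a : ℕ) : ℝ) ^ (1 + δ) * (c : ℝ) ^ δ < (a : ℝ) → ((UniqueFactorizationMonoid.radical b : ℕ) : ℝ) ^ (1 + δ) * (c : ℝ) ^ δ < (b : ℝ) → ((UniqueFactorizationMonoid.radical c : ℕ) : ℝ) ^ (1 + δ) * (c : ℝ) ^ δ < (c : ℝ) → (c : ℝ) < C * ((Literature.NumberTheory.DiophantineGeometry.rad a b c : ℕ) : ℝ) ^ (1 + δ)) :=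
  fun h => ⟨smallFullSizeFiveFree_of_depthCountedABC h, smallFullSizeDeep_of_depthCountedABC h,
    allPowerRich_of_depthCountedABC h⟩

end Summit.ABC.ABC.Theorems.DepthCountedABC
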